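import Mathlib
import Summits.KontsevichZagierPeriods.Zeta5Search.Profile15cCellsA
import Summits.KontsevichZagierPeriods.Zeta5Search.Profile15cCellsB
import Summits.KontsevichZagierPeriods.Zeta5Search.DenomLaw.Profile16aPath
import Summits.KontsevichZagierPeriods.Zeta5Search.FlagRayDominance
import HarnessLib

/-!
# ζ(5) search — the `N_p = 15` PROFILE with short blocks `(1,2), (1,3), (1,4), (1,5), (2,3), (2,4)` for EVERY sorted parameter vector: the double-drop bonus `−7` ⇒ PATH accounting on the whole profile

Cell `pub-zeta5` (HONEST FRAMING: systematic search; no irrationality claim unless certified), TRACK «DENOM-LAW» D1 prover seat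
(denom-prover-d1 g18, `HOME/denom-law/prover-d1/ATTEMPT-18.md` §2).  Twelfth general-`b` profile of the first period.  This `N_p = 15` branch: `p ≤ b₇`, `b₀ < p + b₁ + b₅`, `b₀ < p + b₂ + b₄`,
`p + b₁ + b₆ ≤ b₀`, `p + b₂ + b₅ ≤ b₀`, `p + b₃ + b₄ ≤ b₀` inside the first period (short blocks `(1,2),(1,3),(1,4),(1,5),(2,3),(2,4)`).  Then `N_p = 15` (`pairFloors_eq_15c`),
`C⋆ ≤ 11`, `p < d < 3p` (`d_bounds15c`; `3p ≤ d` infeasible), and the node `DenomLaw.PathAccountingFirstPeriod` asks `⌊d/p⌋ − 9 ≤ −7`.  Gen 18's census finds THEOREM LB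
(`⌊d/p⌋ = 1`) and the double-drop bonus (`⌊d/p⌋ = 2`; least multipole exponent `−6` realised only by the centre-free palindrome `[1,−4,−4,1]`, every other class at
`−6` a tame single) equal to the node; PROVED HERE for every sorted `b`: the machine-generated covers `FullProfile.cover15c_ev / cover15c_od` (`Profile15cCells{A,B}`)
pass `checkLB (−6,−3)`, `checkB 6`, `checkLBx (−6; −5, −2)` (`decide`), so `StairFLAG.cover_B_j` (`ClusterValuation.doubleDrop_of_cover` with THEOREM LB fallback) gives
**`v_p(Cas_j(b)) ≥ −7` on the whole profile** (`cas_ge15c_neg7`, every `j`), hence **`pathAccounting_profile15c`** / **`pathAccountingFirstPeriod_profile15c`**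
(binders VERBATIM plus `p ≤ b₇` and the five profile inequalities) and (CV) (`profile15cCV`).  Census beside the proof (exhaustive `p ≤ 11`): 781 instances, LB / double drop ≥ node on all.
MODEL/structure-side valuation bookkeeping of the cell's own rationals; nothing about ζ(5); no γ; records in print UNMOVED.
-/

open Finset

namespace Summit.KontsevichZagierPeriods.Zeta5Search.FullProfile

open Summit.KontsevichZagierPeriods.Zeta5Search.ClusterValuation
open Summit.KontsevichZagierPeriods.Zeta5Search.CasoratianValuation (InPolytope shift casoratian pairFloors refund)
open Summit.KontsevichZagierPeriods.Zeta5Search.WedgeDictionary (dOf)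
open Summit.KontsevichZagierPeriods.Zeta5Search.ClassTypeCover
open Summit.KontsevichZagierPeriods.Zeta5Search.DenomLaw (cStar FirstPeriod Sorted7)
open Summit.KontsevichZagierPeriods.Zeta5Search.DenomLaw.FirstPeriodKit (cStar_le_eleven sorted7_chain firstPeriod_pair pairFloors_expand)
open Summit.KontsevichZagierPeriods.Zeta5Search.StairFLAG (cover_B_j)
open Summit.KontsevichZagierPeriods.Zeta5Search.SortedProfile

section Bounds

variable {b : ℕ → ℤ} {j p : ℕ}

/-- On this profile `p < d(b) < 3p` (lower: `d + b₄ = (b₀−b₁−b₇)+(b₀−b₂−b₆)+(b₀−b₃−b₅) ≥ 3p`, `b₄ ≤ b₁ < 2p`; upper: a positive combination of the profile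
inequalities, sortedness and `p ≤ b₇`). -/
theorem d_bounds15c (hs : Sorted7 b) (hP : (p : ℤ) ≤ b 7) (hQ : b 0 < (p : ℤ) + b 1 + b 5) (hQ24 : b 0 < (p : ℤ) + b 2 + b 4) (hQ6 : (p : ℤ) + b 1 + b 6 ≤ b 0) (hQ25 : (p : ℤ) + b 2 + b 5 ≤ b 0) (hQ34 : (p : ℤ) + b 3 + b 4 ≤ b 0)
    (hF1 : b 1 < 2 * (p : ℤ)) : (p : ℤ) < dOf b ∧ dOf b < 3 * (p : ℤ) := by
  obtain ⟨h21, h32, h43, h54, h65, h76⟩ := sorted7_chain hs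
  rw [DecompositionWholeCone.dOf_expand]; constructor <;> linarith

/-- **`N_p = 15`** on this profile: the pair digits of the six short blocks are `0`, the other fifteen are `1`. -/
theorem pairFloors_eq_15c (hb : InPolytope b) (hs : Sorted7 b) (hp : 0 < p) (hQ : b 0 < (p : ℤ) + b 1 + b 5) (hQ24 : b 0 < (p : ℤ) + b 2 + b 4) (hQ6 : (p : ℤ) + b 1 + b 6 ≤ b 0) (hQ25 : (p : ℤ) + b 2 + b 5 ≤ b 0) (hQ34 : (p : ℤ) + b 3 + b 4 ≤ b 0)
    (hfp : FirstPeriod b p) : pairFloors b p = 15 := by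
  obtain ⟨h21, h32, h43, h54, h65, h76⟩ := sorted7_chain hs
  obtain ⟨h0, hb1, hb2, hb3, hb4, -, -, -, hc1⟩ := box hb
  have hp0 : (0 : ℤ) < p := by exact_mod_cast hp
  have one : ∀ z : ℤ, (p : ℤ) ≤ z → z ≤ 2 * (p : ℤ) - 1 → z / (p : ℤ) = 1 := fun z h1 h2 => by
    rw [Int.ediv_eq_iff_of_pos hp0]; constructor <;> linarith
  have z12 : (b 0 - b 1 - b 2) / (p : ℤ) = 0 := Int.ediv_eq_zero_of_lt (by linarith) (by linarith)
  have z13 : (b 0 - b 1 - b 3) / (p : ℤ) = 0 := Int.ediv_eq_zero_of_lt (by linarith) (by linarith)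
  have z14 : (b 0 - b 1 - b 4) / (p : ℤ) = 0 := Int.ediv_eq_zero_of_lt (by linarith) (by linarith)
  have z15 : (b 0 - b 1 - b 5) / (p : ℤ) = 0 := Int.ediv_eq_zero_of_lt (by linarith) (by linarith)
  have z23 : (b 0 - b 2 - b 3) / (p : ℤ) = 0 := Int.ediv_eq_zero_of_lt (by linarith) (by linarith)
  have z24 : (b 0 - b 2 - b 4) / (p : ℤ) = 0 := Int.ediv_eq_zero_of_lt (by linarith) (by linarith)
  have U := fun (i k : ℕ) (hi : i < 7) (hk : k < 7) (hik : i < k) => firstPeriod_pair hfp hi hk hik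
  rw [pairFloors_expand, z12, z13, z14, z15, z23, z24,
    one _ (by linarith) (U 0 5 (by norm_num) (by norm_num) (by norm_num)), one _ (by linarith) (U 0 6 (by norm_num) (by norm_num) (by norm_num)),
    one _ (by linarith) (U 1 4 (by norm_num) (by norm_num) (by norm_num)), one _ (by linarith) (U 1 5 (by norm_num) (by norm_num) (by norm_num)),
    one _ (by linarith) (U 1 6 (by norm_num) (by norm_num) (by norm_num)), one _ (by linarith) (U 2 3 (by norm_num) (by norm_num) (by norm_num)),
    one _ (by linarith) (U 2 4 (by norm_num) (by norm_num) (by norm_num)), one _ (by linarith) (U 2 5 (by norm_num) (by norm_num) (by norm_num)),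
    one _ (by linarith) (U 2 6 (by norm_num) (by norm_num) (by norm_num)), one _ (by linarith) (U 3 4 (by norm_num) (by norm_num) (by norm_num)),
    one _ (by linarith) (U 3 5 (by norm_num) (by norm_num) (by norm_num)), one _ (by linarith) (U 3 6 (by norm_num) (by norm_num) (by norm_num)),
    one _ (by linarith) (U 4 5 (by norm_num) (by norm_num) (by norm_num)), one _ (by linarith) (U 4 6 (by norm_num) (by norm_num) (by norm_num)),
    one _ (by linarith) (U 5 6 (by norm_num) (by norm_num) (by norm_num))]
  norm_num

/-- **The double-drop bonus / THEOREM LB on this profile, general `b`**: `v_p(Cas_j(b)) ≥ −7` for every sorted `b` in the polytope, every admissible `j`, every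
first-period prime `p ≥ 5` with `b₀ + 2 < p²` on the profile (`N = 6`; `checkLB (−6,−3)`, `checkB 6`, `checkLBx (−6; −5, −2)` on both covers). -/
theorem cas_ge15c_neg7 (hb : InPolytope b) (hs : Sorted7 b) (hbj : InPolytope (shift b j)) (hj1 : 1 ≤ j) (hj7 : j ≤ 7)
    (hprime : p.Prime) (hp5 : 5 ≤ p) (hwin : (b 0 + 2 : ℤ) < (p : ℤ) ^ 2) (hP : (p : ℤ) ≤ b 7) (hQ : b 0 < (p : ℤ) + b 1 + b 5) (hQ24 : b 0 < (p : ℤ) + b 2 + b 4) (hQ6 : (p : ℤ) + b 1 + b 6 ≤ b 0) (hQ25 : (p : ℤ) + b 2 + b 5 ≤ b 0) (hQ34 : (p : ℤ) + b 3 + b 4 ≤ b 0)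
    (hF1 : b 1 < 2 * (p : ℤ)) (hF2 : b 0 < 2 * (p : ℤ) + b 6 + b 7) (hcas : casoratian b j ≠ 0) : (-7 : ℤ) ≤ padicValRat p (casoratian b j) := by
  haveI : Fact p.Prime := ⟨hprime⟩
  have hp2 : p % 2 = 1 := Nat.odd_iff.1 (hprime.odd_of_ne_two (by omega))
  obtain ⟨h0, hb1, hb2, hb3, hb4, -, -, -, -⟩ := box hb
  have hpd : (p : ℤ) ≤ dOf b := le_of_lt (d_bounds15c hs hP hQ hQ24 hQ6 hQ25 hQ34 hF1).1
  have hpb : (p : ℤ) ≤ b 0 := by linarith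
  rcases Int.emod_two_eq_zero_or_one (b 0) with hr | hr
  · exact cover_B_j hb hj1 hj7 hbj hprime hp5 hpb hpd hwin (cover15c_ev hb hs hP hQ hQ24 hQ6 hQ25 hQ34 hF1 hF2 hp5 hp2 hr) (N := 6) (by norm_num) (by decide)
      (B := -3) (A' := -5) (B' := -2) (by rw [oddFlag_false hr]; decide) (by norm_num) (by rw [oddFlag_false hr]; decide) (by rw [oddFlag_false hr]; decide)
      (by norm_num) (by norm_num) (by norm_num) (by norm_num) hcas
  · exact cover_B_j hb hj1 hj7 hbj hprime hp5 hpb hpd hwin (cover15c_od hb hs hP hQ hQ24 hQ6 hQ25 hQ34 hF1 hF2 hp5 hp2 hr) (N := 6) (by norm_num) (by decide)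
      (B := -3) (A' := -5) (B' := -2) (by rw [oddFlag_true hr]; decide) (by norm_num) (by rw [oddFlag_true hr]; decide) (by rw [oddFlag_true hr]; decide)
      (by norm_num) (by norm_num) (by norm_num) (by norm_num) hcas

end Bounds

/-! ## PATH accounting and (CV) on the whole profile -/

/-- **`PathAccountingFirstPeriod`'s conclusion on this `N_p = 15` profile (short blocks `(1,2), (1,3), (1,4), (1,5), (2,3), (2,4)`), EVERY sorted `b`, every `j`.** -/
theorem pathAccounting_profile15c (b : ℕ → ℤ) (j p : ℕ) (hb : InPolytope b) (hs : Sorted7 b) (hbj : InPolytope (shift b j))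
    (hj1 : 1 ≤ j) (hj7 : j ≤ 7) (hprime : p.Prime) (hp5 : 5 ≤ p) (hwin : (b 0 + 2 : ℤ) < (p : ℤ) ^ 2) (hfp : FirstPeriod b p)
    (hP : (p : ℤ) ≤ b 7) (hQ : b 0 < (p : ℤ) + b 1 + b 5) (hQ24 : b 0 < (p : ℤ) + b 2 + b 4) (hQ6 : (p : ℤ) + b 1 + b 6 ≤ b 0) (hQ25 : (p : ℤ) + b 2 + b 5 ≤ b 0) (hQ34 : (p : ℤ) + b 3 + b 4 ≤ b 0)
    (hcas : casoratian b j ≠ 0) :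
    dOf b / (p : ℤ) - pairFloors b p - min (if 2 ≤ dOf b / (p : ℤ) then (1 : ℤ) else 0) (5 - (cStar b p : ℤ))
      ≤ padicValRat p (casoratian b j) := by
  obtain ⟨hF1, hF2⟩ := fp_bounds hfp
  have hp0 : (0 : ℤ) < p := by exact_mod_cast hprime.pos
  rw [pairFloors_eq_15c hb hs hprime.pos hQ hQ24 hQ6 hQ25 hQ34 hfp]
  have hC11 : (cStar b p : ℤ) ≤ 11 := by exact_mod_cast cStar_le_eleven b p
  have hmin : -6 ≤ min (if 2 ≤ dOf b / (p : ℤ) then (1 : ℤ) else 0) (5 - (cStar b p : ℤ)) :=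
    le_min (by split_ifs <;> norm_num) (by linarith)
  obtain ⟨-, hd3⟩ := d_bounds15c hs hP hQ hQ24 hQ6 hQ25 hQ34 hF1
  have hfd : dOf b / (p : ℤ) < 3 := by rw [Int.ediv_lt_iff_lt_mul hp0]; linarith
  linarith [cas_ge15c_neg7 hb hs hbj hj1 hj7 hprime hp5 hwin hP hQ hQ24 hQ6 hQ25 hQ34 hF1 hF2 hcas]

/-- **THE NODE ON THIS `N_p = 15` PROFILE, EVERY SORTED `b`: `PathAccountingFirstPeriod` with its binders VERBATIM plus `p ≤ b₇` and the profile inequalities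
`b₀ < p + b₁ + b₅`, `b₀ < p + b₂ + b₄`, `p + b₁ + b₆ ≤ b₀`, `p + b₂ + b₅ ≤ b₀`, `p + b₃ + b₄ ≤ b₀`.** -/
theorem pathAccountingFirstPeriod_profile15c :
    ∀ (b : ℕ → ℤ) (p : ℕ), InPolytope b → Sorted7 b → InPolytope (shift b 7) →
      p.Prime → 5 ≤ p → (b 0 + 2 : ℤ) < (p : ℤ) ^ 2 → FirstPeriod b p →
      (p : ℤ) ≤ b 7 → b 0 < (p : ℤ) + b 1 + b 5 → b 0 < (p : ℤ) + b 2 + b 4 → (p : ℤ) + b 1 + b 6 ≤ b 0 → (p : ℤ) + b 2 + b 5 ≤ b 0 → (p : ℤ) + b 3 + b 4 ≤ b 0 → casoratian b 7 ≠ 0 →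
        dOf b / (p : ℤ) - pairFloors b p - min (if 2 ≤ dOf b / (p : ℤ) then (1 : ℤ) else 0) (5 - (cStar b p : ℤ))
          ≤ padicValRat p (casoratian b 7) :=
  fun b p hb hs hb7 hprime hp5 hwin hfp hP hQ hQ24 hQ6 hQ25 hQ34 hcas =>
    pathAccounting_profile15c b 7 p hb hs hb7 (by norm_num) (by norm_num) hprime hp5 hwin hfp hP hQ hQ24 hQ6 hQ25 hQ34 hcas

/-- **(CV) on the whole profile, every sorted `b`, every `j`** (`refund − N_p ≤ −14 ≤ −7`). -/
theorem profile15cCV (b : ℕ → ℤ) (j p : ℕ) (hb : InPolytope b) (hs : Sorted7 b) (hbj : InPolytope (shift b j))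
    (hj1 : 1 ≤ j) (hj7 : j ≤ 7) (hprime : p.Prime) (hp5 : 5 ≤ p) (hwin : (b 0 + 2 : ℤ) < (p : ℤ) ^ 2) (hfp : FirstPeriod b p)
    (hP : (p : ℤ) ≤ b 7) (hQ : b 0 < (p : ℤ) + b 1 + b 5) (hQ24 : b 0 < (p : ℤ) + b 2 + b 4) (hQ6 : (p : ℤ) + b 1 + b 6 ≤ b 0) (hQ25 : (p : ℤ) + b 2 + b 5 ≤ b 0) (hQ34 : (p : ℤ) + b 3 + b 4 ≤ b 0)
    (hcas : casoratian b j ≠ 0) : refund b p - pairFloors b p ≤ padicValRat p (casoratian b j) := by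
  obtain ⟨hF1, hF2⟩ := fp_bounds hfp
  rw [pairFloors_eq_15c hb hs hprime.pos hQ hQ24 hQ6 hQ25 hQ34 hfp]
  have hr : refund b p ≤ 1 := min_le_left _ _
  linarith [cas_ge15c_neg7 hb hs hbj hj1 hj7 hprime hp5 hwin hP hQ hQ24 hQ6 hQ25 hQ34 hF1 hF2 hcas]

end Summit.KontsevichZagierPeriods.Zeta5Search.FullProfile
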